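import Summits.NavierStokesRegularity.OSWSelfSimilar.SheetRCertificateWeakZero
import Summits.NavierStokesRegularity.OSWSelfSimilar.SheetRBackboneSolutionOperator
import HarnessLib

/-!
# SHEET-ℝ frame, MODEL ASSEMBLY layer 4d: (C1) from the POINTWISE coercivity datum, the residual of a smooth centre, and the
# end-to-end MODEL statement with only printed inequalities as hypotheses

HONEST FRAMING (cell ns-blowup GROUP B / zone Z3, case Z3-SR-CERT; 1-D MODEL certificate (viscous gCLM/OSW sheet on the line at
`(a, c_l, ε) = (1/5, 1/2, 1)`); computer-assisted; not Euler/NS; «violates: none — MODEL»).  Layers 4b/4c take the coercivity of the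
linearised form (`hcoer`) and the weak residual identification (`hres`) as hypotheses.  This file reduces both to what an interval program
actually prints / what holds for the trigonometric centre of record:

* §1 **`coercive_of_pointwise`** — for a centre in the odd energy class, the weak-level energy identity
  `linForm(v; v) = ∫ w v₁² + ∫ (wV − 1 − ξd − ½wd′)·v²` on compactly supported tests (selfsim's `integral_mul_test_eq` with the multiplier
  `g = 2ξ + w·d ∈ C¹`, `d = ½ξ + a𝒰̄`, `d′ = ½ + aHΩ̄`, `𝒰̄′ = HΩ̄` continuous by `SheetRVelocityEndpointClass`), hence (C1) with `κ = 1` FROM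
  THE POINTWISE DATUM `∀ ξ: ½w + 1 + ½ξ² + aξ𝒰̄ + (a/2)w·HΩ̄ ≤ w·V` (`w = L² + ξ²`, `V = 1 − HΩ̄ + λχ`) — the frame's «`κ_λ − ¼ ≥ 0`»;
  the backbone case `Ω̄ = 0, λ = 0` is `L² ≥ 2` (`SheetRBackboneSolutionOperator.backbone_coercive`).
* §2 **`residual_of_contDiff`** — if `Ω̄₁ ∈ C¹` (so `Ω̄ ∈ C²`), the pointwise residual `G(Ω̄) = F(Ω̄) − Ω̄₁′`,
  `F(Ω̄) = Ω̄ + ½ξΩ̄₁ + a𝒰̄Ω̄₁ − HΩ̄·Ω̄`, represents `G(Ω̄)` weakly: `∫ G(Ω̄)ψ = ∫ F(Ω̄)ψ + ∫ Ω̄₁ψ′` (one integration by parts).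
* §3 **`modelBlowup_of_pointwise_certificate`** — layer 4c's `modelBlowup_of_certificate` with (C1) entered pointwise and the residual entered
  as the function `G(Ω̄)` with `(∫ w G(Ω̄)²)^{1/2} ≤ eta`; `S₀` is then THE solution operator (`exists_solutionOperator_of_pointwise`), and with the
  left inverse property the certified `δ` is unique among energy-class weak solutions (`existsUnique_weakSolution_of_pointwise`).
No definition, no named fact.  WHAT THIS IS NOT: not NS; the remaining hypotheses — the pointwise datum, the `K_w` bound of the (C2)/(C3) inverse,
the residual norm — ARE the interval arithmetic of record and are not proved here.
-/

noncomputable section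

namespace Summit.NavierStokesRegularity.OSWSelfSimilar
namespace SheetRCertificateCoercivity

open _root_.MeasureTheory _root_.Set _root_.Filter _root_.Real _root_.Metric _root_.Function Literature.Analysis.Fourier
  Literature.Analysis.FluidPDE SheetRWeakProfilePV SheetRWeakToStrong SheetREnergyClass SheetRWeightedMeasure SheetREnergySpace
  SheetRLinearisedTests SheetRTestSpace SheetRSolutionOperator SheetRAssemblyOperators SheetRCertificateAssembly SheetRCertificateWeakZero
  SheetRWeakPairingExpansion SheetRBackboneSolutionOperator CertificateViscousSheetR
open scoped Topology ENNReal ContDiff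

/-! ### §1 (C1) from the pointwise datum -/

section Coercive

variable {L : ℝ} (hL : 0 < L) (lam a : ℝ) {Ω Ω₁ : ℝ → ℝ} {H₀ : ℝ} (hc : IsCentre L Ω Ω₁ H₀)
include hL hc

/-- The velocity `𝒰̄ = ∫₀HΩ̄` of the centre is `C¹` with `𝒰̄′ = HΩ̄`, and `HΩ̄` is continuous. [folklore] -/
theorem velocity_contDiff :
    ContDiff ℝ 1 (fun ξ => ∫ s in (0 : ℝ)..ξ, hilbertTransform Ω s) ∧
      (deriv (fun ξ => ∫ s in (0 : ℝ)..ξ, hilbertTransform Ω s) = hilbertTransform Ω) ∧ Continuous (hilbertTransform Ω) := by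
  obtain ⟨-, hΩ₁2, hΩ2, hΩi, -⟩ := hc.basic hL
  have hH : Continuous (hilbertTransform Ω) := SheetRVelocityEndpointClass.continuous_hilbertTransform_of_primitive hc.primitive' hΩ₁2 hΩi
  have hd : ∀ ξ, HasDerivAt (fun ξ => ∫ s in (0 : ℝ)..ξ, hilbertTransform Ω s) (hilbertTransform Ω ξ) ξ :=
    SheetRVelocityEndpointClass.hasDerivAt_velocity_of_primitive hc.primitive' hΩ₁2 hΩi hΩ2
  have hderiv : deriv (fun ξ => ∫ s in (0 : ℝ)..ξ, hilbertTransform Ω s) = hilbertTransform Ω := funext fun ξ => (hd ξ).deriv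
  refine ⟨contDiff_one_iff_deriv.2 ⟨fun ξ => (hd ξ).differentiableAt, by rw [hderiv]; exact hH⟩, hderiv, hH⟩

/-- **The weak energy identity for `B_λ` on the diagonal.** For a compactly supported test `(v, v₁)`:
`linForm L d V v v₁ v v₁ = ∫ w v₁² + ∫ (w·V − 1 − ½ξ² − aξ𝒰̄ − ¼w − (a/2)w·HΩ̄)·v²` (`d = ½ξ + a𝒰̄`, `V = 1 − HΩ̄ + λχ`). [folklore] -/
theorem linForm_diag_eq {v v₁ : ℝ → ℝ} (hv : IsCompactTest v v₁) :
    linForm L (drift a Ω) (potential L lam Ω) v v₁ v v₁ =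
      (∫ y, (L ^ 2 + y ^ 2) * v₁ y ^ 2) +
        ∫ y, ((L ^ 2 + y ^ 2) * potential L lam Ω y - 1 - y ^ 2 / 2 - a * y * (∫ s in (0 : ℝ)..y, hilbertTransform Ω s)
          - (L ^ 2 + y ^ 2) / 4 - a / 2 * (L ^ 2 + y ^ 2) * hilbertTransform Ω y) * v y ^ 2 := by
  obtain ⟨hvc, -, -, B, hB0, hB⟩ := basic_of_isCompactTest hv
  obtain ⟨hwv, hwv₁⟩ := weighted_of_isCompactTest (L := L) hv
  obtain ⟨R, hR⟩ := hv.support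
  obtain ⟨hUC, hUd, hHc⟩ := velocity_contDiff hL hc
  set U : ℝ → ℝ := fun ξ => ∫ s in (0 : ℝ)..ξ, hilbertTransform Ω s with hU
  -- the multiplier of the first-order part, `g = 2ξ + w·d`, and its derivative
  set gf : ℝ → ℝ := fun y => 2 * y + (L ^ 2 + y ^ 2) * (y / 2 + a * U y) with hgf
  have hgfC : ContDiff ℝ 1 gf := by
    rw [hgf]
    exact (contDiff_const.mul contDiff_id).add ((contDiff_const.add (contDiff_id.pow 2)).mul
      ((contDiff_id.div_const 2).add (contDiff_const.mul hUC)))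
  have hgfd : ∀ y, deriv gf y = 2 + y ^ 2 + 2 * a * y * U y + (L ^ 2 + y ^ 2) / 2 + a * (L ^ 2 + y ^ 2) * hilbertTransform Ω y := by
    intro y
    have hUy : HasDerivAt U (hilbertTransform Ω y) y := by
      have := (hUC.differentiable one_ne_zero y).hasDerivAt
      rwa [hUd] at this
    have h : HasDerivAt gf (2 * 1 + ((2 * y) * (y / 2 + a * U y) + (L ^ 2 + y ^ 2) * (1 / 2 + a * hilbertTransform Ω y))) y := by
      rw [hgf]
      have h1 : HasDerivAt (fun y : ℝ => 2 * y) (2 * 1) y := (hasDerivAt_id y).const_mul 2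
      have h2 : HasDerivAt (fun y : ℝ => L ^ 2 + y ^ 2) (2 * y) y := by simpa using (hasDerivAt_pow 2 y).const_add (L ^ 2)
      have h3 : HasDerivAt (fun y : ℝ => y / 2 + a * U y) (1 / 2 + a * hilbertTransform Ω y) y :=
        ((hasDerivAt_id y).div_const 2).add (hUy.const_mul a)
      exact h1.add (h2.mul h3)
    rw [h.deriv]; ring
  -- compact support ⇒ integrability of the three pieces
  have hvan : ∀ x, x ∉ Icc (-|R|) |R| → v x = 0 := fun x hx => by
    have : R ≤ |x| := by
      have h1 : |R| < |x| := by
        by_contra hle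
        exact hx (mem_Icc.2 (abs_le.1 (not_lt.1 hle)))
      linarith [le_abs_self R]
    exact (hR x this).1
  have hsupp : HasCompactSupport v := HasCompactSupport.intro (isCompact_Icc : IsCompact (Icc (-|R|) |R|)) hvan
  have hgv2 : MemLp (fun y => gf y * v y) 2 volume := (hgfC.continuous.mul hvc).memLp_of_hasCompactSupport (hsupp.mul_left)
  have hT2 : Integrable fun y => gf y * (v y * v₁ y) := by
    refine (hgv2.integrable_mul hv.memLp).congr (Eventually.of_forall fun y => ?_)
    simp only [Pi.mul_apply]; ring
  have hVc : Continuous (potential L lam Ω) := by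
    refine (continuous_const.sub hHc).add (continuous_const.mul (continuous_const.div (by fun_prop) fun ξ => ?_))
    positivity
  have hT3 : Integrable fun y => (L ^ 2 + y ^ 2) * potential L lam Ω y * v y ^ 2 :=
    (((by fun_prop : Continuous fun y : ℝ => L ^ 2 + y ^ 2).mul hVc).mul (hvc.pow 2)).integrable_of_hasCompactSupport
      (HasCompactSupport.intro (isCompact_Icc : IsCompact (Icc (-|R|) |R|)) fun x hx => by simp [hvan x hx])
  -- split the diagonal integrand
  have hsplit : linForm L (drift a Ω) (potential L lam Ω) v v₁ v v₁ =
      (∫ y, (L ^ 2 + y ^ 2) * v₁ y ^ 2) + (∫ y, gf y * (v y * v₁ y)) + ∫ y, (L ^ 2 + y ^ 2) * potential L lam Ω y * v y ^ 2 := by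
    have h12 : Integrable fun y => (L ^ 2 + y ^ 2) * v₁ y ^ 2 + gf y * (v y * v₁ y) := hwv₁.add hT2
    unfold linForm
    rw [← integral_add hwv₁ hT2, ← integral_add h12 hT3]
    refine integral_congr_ae (Eventually.of_forall fun y => ?_)
    simp only [hgf, drift, hU]
    ring
  rw [hsplit, integral_mul_test_eq hgfC hv]
  -- `−½∫ g′ v² + ∫ wV v² = ∫ (wV − ½g′) v²`
  have hI : Integrable fun y => deriv gf y * v y ^ 2 :=
    ((hgfC.continuous_deriv le_rfl).mul (hvc.pow 2)).integrable_of_hasCompactSupport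
      (HasCompactSupport.intro (isCompact_Icc : IsCompact (Icc (-|R|) |R|)) fun x hx => by simp [hvan x hx])
  rw [add_assoc, ← integral_const_mul, ← integral_add (hI.const_mul _) hT3]
  congr 1
  refine integral_congr_ae (Eventually.of_forall fun y => ?_)
  simp only [hgfd, hU]
  ring

/-- **(C1) from the pointwise datum.** If `∀ ξ: ½w + 1 + ½ξ² + aξ𝒰̄(ξ) + (a/2)w·HΩ̄(ξ) ≤ w·V(ξ)` (`w = L² + ξ²`, `V = 1 − HΩ̄ + λχ`), then the
linearised form is `1`-coercive in the energy norm on compactly supported tests: `‖v₁‖²_w + ¼‖v‖²_w ≤ linForm(v; v)` — the hypothesis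
`hcoer` (`κ = c_λ = 1`) of layers 3–4. [folklore] -/
theorem coercive_of_pointwise
    (hC1 : ∀ ξ, (L ^ 2 + ξ ^ 2) / 2 + 1 + ξ ^ 2 / 2 + a * ξ * (∫ s in (0 : ℝ)..ξ, hilbertTransform Ω s)
      + a / 2 * (L ^ 2 + ξ ^ 2) * hilbertTransform Ω ξ ≤ (L ^ 2 + ξ ^ 2) * potential L lam Ω ξ)
    {v v₁ : ℝ → ℝ} (hv : IsCompactTest v v₁) :
    1 * ((∫ ξ, (L ^ 2 + ξ ^ 2) * v₁ ξ ^ 2) + 1 / 4 * ∫ ξ, (L ^ 2 + ξ ^ 2) * v ξ ^ 2) ≤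
      linForm L (drift a Ω) (potential L lam Ω) v v₁ v v₁ := by
  rw [linForm_diag_eq hL lam a hc hv, one_mul]
  obtain ⟨hvc, -, -, -⟩ := basic_of_isCompactTest hv
  obtain ⟨hwv, -⟩ := weighted_of_isCompactTest (L := L) hv
  obtain ⟨R, hR⟩ := hv.support
  obtain ⟨hUC, -, hHc⟩ := velocity_contDiff hL hc
  have hvan : ∀ x, x ∉ Icc (-|R|) |R| → v x = 0 := fun x hx => by
    have : R ≤ |x| := by
      have h1 : |R| < |x| := by
        by_contra hle
        exact hx (mem_Icc.2 (abs_le.1 (not_lt.1 hle)))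
      linarith [le_abs_self R]
    exact (hR x this).1
  have hVc : Continuous (potential L lam Ω) := by
    refine (continuous_const.sub hHc).add (continuous_const.mul (continuous_const.div (by fun_prop) fun ξ => ?_))
    positivity
  have hcoefc : Continuous fun y => (L ^ 2 + y ^ 2) * potential L lam Ω y - 1 - y ^ 2 / 2
      - a * y * (∫ s in (0 : ℝ)..y, hilbertTransform Ω s) - (L ^ 2 + y ^ 2) / 4 - a / 2 * (L ^ 2 + y ^ 2) * hilbertTransform Ω y := by
    have hw : Continuous fun y : ℝ => L ^ 2 + y ^ 2 := by fun_prop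
    exact (((((hw.mul hVc).sub continuous_const).sub (by fun_prop)).sub ((continuous_const.mul continuous_id).mul hUC.continuous)).sub
      (hw.div_const 4)).sub ((continuous_const.mul hw).mul hHc)
  have hI : Integrable fun y => ((L ^ 2 + y ^ 2) * potential L lam Ω y - 1 - y ^ 2 / 2
      - a * y * (∫ s in (0 : ℝ)..y, hilbertTransform Ω s) - (L ^ 2 + y ^ 2) / 4 - a / 2 * (L ^ 2 + y ^ 2) * hilbertTransform Ω y) * v y ^ 2 :=
    (hcoefc.mul (hvc.pow 2)).integrable_of_hasCompactSupport
      (HasCompactSupport.intro (isCompact_Icc : IsCompact (Icc (-|R|) |R|)) fun x hx => by simp [hvan x hx])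
  have hmono : 1 / 4 * ∫ ξ, (L ^ 2 + ξ ^ 2) * v ξ ^ 2 ≤ ∫ y, ((L ^ 2 + y ^ 2) * potential L lam Ω y - 1 - y ^ 2 / 2
      - a * y * (∫ s in (0 : ℝ)..y, hilbertTransform Ω s) - (L ^ 2 + y ^ 2) / 4 - a / 2 * (L ^ 2 + y ^ 2) * hilbertTransform Ω y) * v y ^ 2 := by
    rw [← integral_const_mul]
    refine integral_mono (hwv.const_mul _) hI fun y => ?_
    have h := hC1 y
    have hv2 : 0 ≤ v y ^ 2 := sq_nonneg _
    nlinarith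
  linarith

/-- **THE solution operator from the pointwise datum**: under `hC1` there is a bounded linear `S₀ : W L →L Esp L hL` solving the weak equation
of `B_λ` with `‖S₀ g‖ ≤ 2‖g‖`, and energy-class weak solutions are unique (`exists_solutionOperator` + `solution_unique` with `κ = 1`). [folklore] -/
theorem exists_solutionOperator_of_pointwise
    (hC1 : ∀ ξ, (L ^ 2 + ξ ^ 2) / 2 + 1 + ξ ^ 2 / 2 + a * ξ * (∫ s in (0 : ℝ)..ξ, hilbertTransform Ω s)
      + a / 2 * (L ^ 2 + ξ ^ 2) * hilbertTransform Ω ξ ≤ (L ^ 2 + ξ ^ 2) * potential L lam Ω ξ) :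
    ∃ S₀ : W L →L[ℝ] Esp L hL,
      (∀ (g : W L) (v v₁ : ℝ → ℝ), IsCompactTest v v₁ →
        linForm L (drift a Ω) (potential L lam Ω) (prim (der (S₀ g))) (der (S₀ g)) v v₁ = ∫ y, (L ^ 2 + y ^ 2) * ((g : ℝ → ℝ) y * v y)) ∧
      (∀ g : W L, ‖S₀ g‖ ≤ 2 * ‖g‖) ∧
      ∀ (rhs : (ℝ → ℝ) → (ℝ → ℝ) → ℝ) (p q : Esp L hL),
        (∀ v v₁ : ℝ → ℝ, IsCompactTest v v₁ → linForm L (drift a Ω) (potential L lam Ω) (prim (der p)) (der p) v v₁ = rhs v v₁) →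
        (∀ v v₁ : ℝ → ℝ, IsCompactTest v v₁ → linForm L (drift a Ω) (potential L lam Ω) (prim (der q)) (der q) v v₁ = rhs v v₁) → p = q := by
  obtain ⟨hdm, hVm, hd, hV⟩ := coef_bounds hL lam a hc
  have hcoer := fun v v₁ (hv : IsCompactTest v v₁) => coercive_of_pointwise hL lam a hc hC1 hv
  obtain ⟨S, hS, hSn⟩ := exists_solutionOperator hL hdm hVm (by norm_num : (0:ℝ) ≤ 1 / 2) hd hV one_pos hcoer
  refine ⟨S, hS, fun g => by have := hSn g; norm_num at this; exact this, fun rhs p q hp hq => ?_⟩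
  exact solution_unique hL hdm hVm (by positivity) (by norm_num : (0:ℝ) ≤ 1 / 2) hd hV one_pos hcoer hp hq

end Coercive

/-! ### §2 The residual of a `C²` centre represents `G(Ω̄)` weakly -/

section Residual

variable {L : ℝ} (hL : 0 < L) (a : ℝ) {Ω Ω₁ : ℝ → ℝ} {H₀ : ℝ} (hc : IsCentre L Ω Ω₁ H₀) (hΩ₁ : ContDiff ℝ 1 Ω₁)
include hL hc hΩ₁

/-- **Residual identification.** For `Ω̄₁ ∈ C¹` the pointwise residual `G(Ω̄) = F(Ω̄) − Ω̄₁′` satisfies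
`∫ G(Ω̄)ψ = ∫ F(Ω̄)ψ + ∫ Ω̄₁ψ′` for every `C_c^∞` test (integration by parts); `G(Ω̄)` is continuous. [folklore] -/
theorem residual_of_contDiff :
    Continuous (fun x => Ω x + 1 / 2 * x * Ω₁ x + a * (∫ s in (0 : ℝ)..x, hilbertTransform Ω s) * Ω₁ x
        - hilbertTransform Ω x * Ω x - deriv Ω₁ x) ∧
    ∀ ψ : ℝ → ℝ, ContDiff ℝ ∞ ψ → HasCompactSupport ψ → (∀ y, ψ (-y) = -ψ y) →
      ∫ x, (Ω x + 1 / 2 * x * Ω₁ x + a * (∫ s in (0 : ℝ)..x, hilbertTransform Ω s) * Ω₁ x - hilbertTransform Ω x * Ω x - deriv Ω₁ x) * ψ x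
        = (∫ x, (Ω x + 1 / 2 * x * Ω₁ x + a * (∫ s in (0 : ℝ)..x, hilbertTransform Ω s) * Ω₁ x - hilbertTransform Ω x * Ω x) * ψ x)
          + ∫ x, Ω₁ x * deriv ψ x := by
  obtain ⟨hΩc, hΩ₁2, hΩ2, hΩi, -⟩ := hc.basic hL
  obtain ⟨hUC, -, hHc⟩ := velocity_contDiff hL hc
  have hΩ₁c : Continuous Ω₁ := hΩ₁.continuous
  have hdΩ₁c : Continuous (deriv Ω₁) := hΩ₁.continuous_deriv le_rfl
  have hFc : Continuous fun x => Ω x + 1 / 2 * x * Ω₁ x + a * (∫ s in (0 : ℝ)..x, hilbertTransform Ω s) * Ω₁ x - hilbertTransform Ω x * Ω x :=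
    ((hΩc.add ((continuous_const.mul continuous_id).mul hΩ₁c)).add ((continuous_const.mul hUC.continuous).mul hΩ₁c)).sub (hHc.mul hΩc)
  refine ⟨hFc.sub hdΩ₁c, fun ψ hψ hψc _ => ?_⟩
  have hψc' : Continuous ψ := hψ.continuous
  have hdψc : Continuous (deriv ψ) := hψ.continuous_deriv (by exact_mod_cast le_top)
  have hψ1 : ContDiff ℝ 1 ψ := hψ.of_le (by exact_mod_cast le_top)
  have i1 : Integrable fun x => (Ω x + 1 / 2 * x * Ω₁ x + a * (∫ s in (0 : ℝ)..x, hilbertTransform Ω s) * Ω₁ x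
      - hilbertTransform Ω x * Ω x) * ψ x := (hFc.mul hψc').integrable_of_hasCompactSupport hψc.mul_left
  have i2 : Integrable fun x => deriv Ω₁ x * ψ x := (hdΩ₁c.mul hψc').integrable_of_hasCompactSupport hψc.mul_left
  -- integration by parts `∫ Ω̄₁ ψ′ = −∫ Ω̄₁′ ψ`
  have hibp : ∫ x, Ω₁ x * deriv ψ x = -∫ x, deriv Ω₁ x * ψ x := by
    refine integral_mul_deriv_eq_deriv_mul_of_integrable (u := Ω₁) (v := ψ) (u' := deriv Ω₁) (v' := deriv ψ)
      (fun x _ => ((hΩ₁.differentiable one_ne_zero) x).hasDerivAt) (fun x _ => ((hψ1.differentiable one_ne_zero) x).hasDerivAt) ?_ ?_ ?_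
    · exact (hΩ₁c.mul hdψc).integrable_of_hasCompactSupport hψc.deriv.mul_left
    · exact (hdΩ₁c.mul hψc').integrable_of_hasCompactSupport hψc.mul_left
    · exact (hΩ₁c.mul hψc').integrable_of_hasCompactSupport hψc.mul_left
  have e : ∫ x, (Ω x + 1 / 2 * x * Ω₁ x + a * (∫ s in (0 : ℝ)..x, hilbertTransform Ω s) * Ω₁ x - hilbertTransform Ω x * Ω x - deriv Ω₁ x) * ψ x
      = (∫ x, (Ω x + 1 / 2 * x * Ω₁ x + a * (∫ s in (0 : ℝ)..x, hilbertTransform Ω s) * Ω₁ x - hilbertTransform Ω x * Ω x) * ψ x)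
        - ∫ x, deriv Ω₁ x * ψ x := by
    rw [← integral_sub i1 i2]
    exact integral_congr_ae (Eventually.of_forall fun x => by ring)
  rw [e, hibp]
  ring

end Residual

/-! ### §3 The end-to-end MODEL statement with pointwise (C1) and the pointwise residual -/

section EndToEnd

variable {Ω Ω₁ : ℝ → ℝ} {H₀ : ℝ} (hc : IsCentre 8 Ω Ω₁ H₀) (hΩ₁ : ContDiff ℝ 1 Ω₁)
  (hC1 : ∀ ξ, ((8:ℝ) ^ 2 + ξ ^ 2) / 2 + 1 + ξ ^ 2 / 2 + 1 / 5 * ξ * (∫ s in (0 : ℝ)..ξ, hilbertTransform Ω s)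
    + (1 / 5) / 2 * ((8:ℝ) ^ 2 + ξ ^ 2) * hilbertTransform Ω ξ ≤ ((8:ℝ) ^ 2 + ξ ^ 2) * potential 8 4 Ω ξ)
  (S₀ : W 8 →L[ℝ] Esp 8 eight_pos)
  (hS₀ : ∀ (g : W 8) (v v₁ : ℝ → ℝ), IsCompactTest v v₁ →
    linForm 8 (drift (1 / 5) Ω) (potential 8 4 Ω) (prim (der (S₀ g))) (der (S₀ g)) v v₁ = ∫ y, ((8:ℝ) ^ 2 + y ^ 2) * ((g : ℝ → ℝ) y * v y))
  (M : Esp 8 eight_pos →L[ℝ] Esp 8 eight_pos)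
  (hM₁ : ∀ x, M x - S₀ (PopC eight_pos 4 (1 / 5) hc (M x)) = x)
  (hK : ∀ g, ‖M (S₀ g)‖ ≤ ((KNw / (1 - KNw * epsN) : ℚ) : ℝ) * ‖g‖)
  (hG : Integrable fun y => ((8:ℝ) ^ 2 + y ^ 2) * (Ω y + 1 / 2 * y * Ω₁ y + 1 / 5 * (∫ s in (0 : ℝ)..y, hilbertTransform Ω s) * Ω₁ y
    - hilbertTransform Ω y * Ω y - deriv Ω₁ y) ^ 2)
  (hη : Real.sqrt (∫ y, ((8:ℝ) ^ 2 + y ^ 2) * (Ω y + 1 / 2 * y * Ω₁ y + 1 / 5 * (∫ s in (0 : ℝ)..y, hilbertTransform Ω s) * Ω₁ y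
    - hilbertTransform Ω y * Ω y - deriv Ω₁ y) ^ 2) ≤ (eta : ℝ))

include hc hΩ₁ hS₀ hM₁ hK hG hη in
/-- **END TO END (MODEL).**  Centre `Ω̄ = ∫₀Ω̄₁` odd, `Ω̄₁ ∈ C¹` with finite weights, `|HΩ̄| ≤ H₀`, `|Ω̄(X₀)| > (√2/8)·rE`; `S₀` the solution
operator of `B_λ` (exists and is unique under the pointwise (C1) datum, `exists_solutionOperator_of_pointwise`); (C2)/(C3): `M` a right inverse
of `1 − S₀∘P` with `‖M (S₀ g)‖_E ≤ K_w‖g‖_w`; residual: `G(Ω̄) = Ω̄ + ½ξΩ̄₁ + (1/5)𝒰̄Ω̄₁ − HΩ̄·Ω̄ − Ω̄₁′` with `(∫ w G(Ω̄)²)^{1/2} ≤ eta`.  THEN the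
certified correction `δ` (unique fixed point in the `rE`-ball) gives a `C²` profile `Ω* = Ω̄ + prim (der δ)` whose exact self-similar viscous gCLM
solution `(T − t)⁻¹Ω*(x/√(T − t))` blows up at every prescribed `T > 0`.  1-D MODEL; the three numeric hypotheses are the certificate's
interval arithmetic; NOT Navier–Stokes. [folklore] -/
theorem modelBlowup_of_pointwise_certificate {X₀ : ℝ} (hX₀ : Real.sqrt 2 / 8 * (rE : ℝ) < |Ω X₀|) {T : ℝ} (hT : 0 < T) :
    ∃ δ ∈ closedBall (0 : Esp 8 eight_pos) (rE : ℝ),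
      (∀ δ' ∈ closedBall (0 : Esp 8 eight_pos) (rE : ℝ),
        δ' = -(M.comp S₀) ((memLp_W (residual_of_contDiff eight_pos (1 / 5) hc hΩ₁).1.aestronglyMeasurable hG).toLp _
          + Qop eight_pos (1 / 5) δ' δ') ↔ δ' = δ) ∧
      ContDiff ℝ 2 (fun y => Ω y + prim (der δ) y) ∧
      IsGCLMLineSolution (1 / 5) 1 (gclmSelfSimilar (-1) (1 / 2) T (fun y => Ω y + prim (der δ) y)) T ∧
      SupNormBlowupBefore (gclmSelfSimilar (-1) (1 / 2) T (fun y => Ω y + prim (der δ) y)) T := by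
  obtain ⟨hGc, hres⟩ := residual_of_contDiff eight_pos (1 / 5) hc hΩ₁
  set g₀ : W 8 := (memLp_W hGc.aestronglyMeasurable hG).toLp _ with hg₀
  obtain ⟨hg₀ae, hg₀n⟩ := norm_toLp_W eight_pos (memLp_W (L := 8) hGc.aestronglyMeasurable hG)
  have hη' : ‖g₀‖ ≤ (eta : ℝ) := by rw [hg₀, hg₀n]; exact hη
  obtain ⟨δ, hball, hfix, huniq, hC2, hsol, hblow⟩ :=
    modelBlowup_of_certificate hc S₀ hS₀ M hM₁ hK g₀ hη' hg₀ae hres hX₀ hT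
  exact ⟨δ, hball, fun δ' hδ' => ⟨fun h => huniq δ' hδ' h, fun h => h ▸ hfix⟩, hC2, hsol, hblow⟩

include hc hΩ₁ hC1 hS₀ hM₁ hK hG hη in
/-- **Uniqueness among weak solutions, from the pointwise datum.** With, in addition, the LEFT inverse property of `M` (`hM₂`): the certified
`δ` is the ONLY element of the closed `rE`-ball whose profile solves the linearised weak equation
`linForm(δ'; v) = ∫ w·(Pδ' − G(Ω̄) − Qδ'δ')·v` on compactly supported tests ((C1) now derived from `hC1` by `coercive_of_pointwise`). [folklore] -/
theorem existsUnique_weakSolution_of_pointwise (hM₂ : ∀ x, M (x - S₀ (PopC eight_pos 4 (1 / 5) hc x)) = x) :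
    ∃ δ ∈ closedBall (0 : Esp 8 eight_pos) (rE : ℝ), ∀ δ' ∈ closedBall (0 : Esp 8 eight_pos) (rE : ℝ),
      (∀ v v₁ : ℝ → ℝ, IsCompactTest v v₁ →
        linForm 8 (drift (1 / 5) Ω) (potential 8 4 Ω) (prim (der δ')) (der δ') v v₁ =
          ∫ y, ((8:ℝ) ^ 2 + y ^ 2) * ((PopFun 8 4 (1 / 5) Ω Ω₁ δ' y
            - (Ω y + 1 / 2 * y * Ω₁ y + 1 / 5 * (∫ s in (0 : ℝ)..y, hilbertTransform Ω s) * Ω₁ y - hilbertTransform Ω y * Ω y - deriv Ω₁ y)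
            - QFun 8 (1 / 5) δ' δ' y) * v y)) ↔ δ' = δ := by
  obtain ⟨hGc, -⟩ := residual_of_contDiff eight_pos (1 / 5) hc hΩ₁
  set g₀ : W 8 := (memLp_W hGc.aestronglyMeasurable hG).toLp _ with hg₀
  obtain ⟨hg₀ae, hg₀n⟩ := norm_toLp_W eight_pos (memLp_W (L := 8) hGc.aestronglyMeasurable hG)
  have hη' : ‖g₀‖ ≤ (eta : ℝ) := by rw [hg₀, hg₀n]; exact hη
  have hcoer := fun v v₁ (hv : IsCompactTest v v₁) => coercive_of_pointwise eight_pos 4 (1 / 5) hc hC1 hv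
  obtain ⟨δ, hball, hδ, huniq⟩ := existsUnique_linearised_weakSolution hc S₀ hS₀ M hM₁ hM₂ hK g₀ hη' hcoer hg₀ae
  refine ⟨δ, hball, fun δ' hδ' => ⟨fun h => huniq δ' hδ' h, fun h => ?_⟩⟩
  subst h
  exact hδ

end EndToEnd

end SheetRCertificateCoercivity
end Summit.NavierStokesRegularity.OSWSelfSimilar

end
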